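import Summits.AtomisticToContinuum.HydrodynamicLimit.Theorems.MourreKoopmanChargesOneBodyCompletenessGibbsOrthogonality
import Literature.MathematicalPhysics.KineticTheory.HardSphereGasFluctuations
import HarnessLib

/-!
# `OneBodyCompleteness` · line `registered`: Campbell formulas for the stub `normSq_fluct_cellObs_eq` (S0)

Support file for the crux item stmt-AtomisticToContinuum-9583 (`OneBodyCompleteness`, route `MourreKoopmanCharges` of
`AtomisticToContinuum/HydrodynamicLimit`), first of two files serving the registered sub-goal `normSq_fluct_cellObs_eq`
(`‖[A_g]‖²_ℋ = σ³ ∫ g² M₁` for Gibbs data of density `σ³`; assembled in `…OneBodyCompletenessGibbsNorm.lean`). Here: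

* (S1) `gibbsCampbellSecondMoment` — the **second-order Campbell formula under a hard-sphere DLR state** (Alexander 1976 §2.1,
  Maxwellian momenta in the specification): `E_μ[(Σ_{q ∈ C} h(v)) (Σ_{q ∈ C'} e(v) − b)] = (∫ h e dγ) E_μ[#{q ∈ C ∩ C'}]` for
  `∫ h dγ = 0`, written as one Bochner integral of a difference (robust to junk). Route as for the first-order companion
  `integral_windowStat_mul_sub_eq_zero` (…GibbsOrthogonality.lean): DLR for functions along the specification of a window
  `Λ ⊇ C ∪ C'`; given the boundary condition and the number `k` of thrown particles these are i.i.d. `Leb|_Λ ⊗ γ` weighted by a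
  hard core depending on the POSITIONS only, so the term `1_C(qᵢ) 1_{C'}(qⱼ) h(vᵢ) e(vⱼ)` has velocity factor `(∫ h)(∫ e) = 0`
  for `i ≠ j` and `∫ h e dγ` for `i = j`, the latter compensated by the count of `C ∩ C'`
  (`integrable_integral_posFactor_mul_vel`, `setLIntegral_hardCore_ofReal_eq_neg_diag`);
* (S2) `lintegral_count_eq_mul_volume` — the **intensity measure of a translation-invariant law** on marked configurations with
  finite intensity on compact windows is `E_μ[#{q ∈ [0,1)³}] · Leb` (uniqueness of Haar measure on `ℝ³`).
-/

noncomputable section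

open MeasureTheory ProbabilityTheory Set Filter Topology Function
open scoped InnerProductSpace ENNReal

namespace Summit.AtomisticToContinuum.HydrodynamicLimit.Theorems.MourreKoopmanChargesOneBodyCompleteness

open Literature.Analysis.FluidPDE (IsHardSphereGibbs HardCoreIn superposeIn maxwellPhaseMeasure localMaxwellian)
open Literature.Analysis.FunctionSpaces (PointConfig)
open Literature.MathematicalPhysics.KineticTheory (V3 MarkedConfig gaussMeasure unitCell spatialShift spatialShift_apply
  measurableSet_unitCell isBounded_unitCell)
open Summit.AtomisticToContinuum.HydrodynamicLimit.Theorems.KiferCompactification (posSum measurable_posSum posSum_superposeIn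
  hardCoreIn_superposeIn_iff measurableSet_hardCoreIn_superposeIn_left maxwellPhaseMeasure_inv_eq_prod_gaussMeasure
  sigmaFinite_maxwellPhaseMeasure lintegral_eq_lintegral_gibbsSpecMeasure lintegral_gibbsSpecMeasure lintegral_gibbsWeightMeasure
  lintegral_count_le_of_isHardSphereGibbs tsum_ofReal_pow_div_factorial_mul_lt_top measurable_toENNReal_count)
open Summit.AtomisticToContinuum.HydrodynamicLimit.Theorems.MourreKoopmanChargesIdealGasNoDecay (integral_eval_pi
  integrable_eval_pi integral_cross_eq_zero integrable_cross integrable_of_poly_growth)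

/-! ## S1: the second-order Campbell formula under the DLR specification -/

/-- **Position/velocity Fubini, product form.** Under `(π ⊗ γ)^{⊗k}`, a measurable factor `|a| ≤ 1` that is a.e. a function
`a'` of the positions, times a `γ^{⊗k}`-integrable function `G` of the velocities, is integrable with integral
`(∫ a' dπ^{⊗k}) · (∫ G dγ^{⊗k})`. [folklore] -/
theorem integrable_integral_posFactor_mul_vel {k : ℕ} (π γ : Measure V3) [IsProbabilityMeasure π] [IsProbabilityMeasure γ]
    {G : (Fin k → V3) → ℝ} (hG : Integrable G (Measure.pi fun _ : Fin k => γ)) {a : (Fin k → V3 × V3) → ℝ}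
    {a' : (Fin k → V3) → ℝ} (ham : AEStronglyMeasurable a (Measure.pi fun _ : Fin k => π.prod γ)) (ha1 : ∀ x, ‖a x‖ ≤ 1)
    (hae : a =ᵐ[Measure.pi fun _ : Fin k => π.prod γ] fun x => a' (fun l => (x l).1)) :
    Integrable (fun x => a x * G (fun l => (x l).2)) (Measure.pi fun _ : Fin k => π.prod γ) ∧
      ∫ x, a x * G (fun l => (x l).2) ∂(Measure.pi fun _ : Fin k => π.prod γ) =
        (∫ q, a' q ∂(Measure.pi fun _ : Fin k => π)) * ∫ v, G v ∂(Measure.pi fun _ : Fin k => γ) := by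
  have hmp := measurePreserving_arrowProdEquivProdArrow V3 V3 (Fin k) (fun _ => π) (fun _ => γ)
  refine ⟨Integrable.bdd_mul ?_ ham (ae_of_all _ ha1), ?_⟩
  · have h1 : Integrable (fun y : (Fin k → V3) × (Fin k → V3) => (1 : ℝ) * G y.2)
        ((Measure.pi fun _ : Fin k => π).prod (Measure.pi fun _ : Fin k => γ)) := (integrable_const (1 : ℝ)).mul_prod hG
    simp only [one_mul] at h1
    exact (hmp.integrable_comp_emb (MeasurableEquiv.measurableEmbedding _)).2 h1
  have h1 : (fun x : Fin k → V3 × V3 => a x * G (fun l => (x l).2)) =ᵐ[Measure.pi fun _ : Fin k => π.prod γ]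
      fun x => a' (fun l => (x l).1) * G (fun l => (x l).2) := hae.mono fun x hx => by simp only [hx]
  have h2 : ∫ x, a' (fun l => (x l).1) * G (fun l => (x l).2) ∂(Measure.pi fun _ : Fin k => π.prod γ) =
      ∫ y : (Fin k → V3) × (Fin k → V3), a' y.1 * G y.2 ∂((Measure.pi fun _ : Fin k => π).prod (Measure.pi fun _ : Fin k => γ)) :=
    hmp.integral_comp' (fun y : (Fin k → V3) × (Fin k → V3) => a' y.1 * G y.2)
  rw [integral_congr_ae h1, h2, integral_prod_mul (μ := Measure.pi fun _ : Fin k => π) (ν := Measure.pi fun _ : Fin k => γ) a' G]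

/-- **Per-`k` Campbell identity on the hard-core event.** Under `(π ⊗ γ)^{⊗k}` (positions a.s. in `Λ` and distinct), for a
functional `Fr` of the superposition which on good superpositions is
`(Σᵢ 1_C(qᵢ) h(vᵢ)) (Σⱼ 1_{C'}(qⱼ) e(vⱼ) − b) − (∫ h e dγ) Σᵢ 1_{C ∩ C'}(qᵢ)` with `∫ h dγ = 0`, the `[0, ∞]`-integrals over the
hard-core event of the positive parts of `Fr` and `−Fr` coincide: the off-diagonal velocity factors integrate to `(∫ h)(∫ e) = 0`,
the diagonal ones to `∫ h e dγ`, which the counting term compensates. [folklore] -/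
theorem setLIntegral_hardCore_ofReal_eq_neg_diag {k : ℕ} {π γ : Measure V3} [IsProbabilityMeasure π] [IsProbabilityMeasure γ]
    {Λ C C' : Set V3} (hΛ : MeasurableSet Λ) (hC : MeasurableSet C) (hC' : MeasurableSet C')
    (hout : (π.prod γ) (Prod.fst ⁻¹' Λᶜ) = 0) (hfst : ∀ q : V3, (π.prod γ) (Prod.fst ⁻¹' {q}) = 0)
    {h e : V3 → ℝ} (hh : Measurable h) (he : Measurable e) (hhi : Integrable h γ) (hei : Integrable e γ)
    (hhe : Integrable (fun v => h v * e v) γ) (h0 : ∫ v, h v ∂γ = 0) (b σ : ℝ) (Y : PointConfig (V3 × V3))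
    {Fr : PointConfig (V3 × V3) → ℝ}
    (hFr : ∀ x : Fin k → V3 × V3, (∀ i, (x i).1 ∈ Λ) → (∀ i j, (x i).1 = (x j).1 → i = j) → Fr (superposeIn Λ x Y) =
      (∑ i, C.indicator (1 : V3 → ℝ) (x i).1 * h (x i).2) * ((∑ j, C'.indicator (1 : V3 → ℝ) (x j).1 * e (x j).2) - b) -
        (∫ v, h v * e v ∂γ) * ∑ i, (C ∩ C').indicator (1 : V3 → ℝ) (x i).1) :
    ∫⁻ x in {x : Fin k → V3 × V3 | HardCoreIn σ Λ (superposeIn Λ x Y)}, ENNReal.ofReal (Fr (superposeIn Λ x Y))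
        ∂(Measure.pi fun _ : Fin k => π.prod γ) =
      ∫⁻ x in {x : Fin k → V3 × V3 | HardCoreIn σ Λ (superposeIn Λ x Y)}, ENNReal.ofReal (-Fr (superposeIn Λ x Y))
        ∂(Measure.pi fun _ : Fin k => π.prod γ) := by
  set P : Measure (Fin k → V3 × V3) := Measure.pi fun _ : Fin k => π.prod γ with hP
  set H : Set (Fin k → V3 × V3) := {x | HardCoreIn σ Λ (superposeIn Λ x Y)} with hH
  have hHm : MeasurableSet H := measurableSet_hardCoreIn_superposeIn_left σ hΛ k Y
  set Hq : Set (Fin k → V3) := {q | (∀ i j, i ≠ j → σ ≤ ‖q i - q j‖) ∧ ∀ i, ∀ p ∈ Y, p.1 ∉ Λ → σ ≤ ‖q i - p.1‖} with hHq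
  have hgood : ∀ᵐ x ∂P, (∀ i, (x i).1 ∈ Λ) ∧ ∀ i j, (x i).1 = (x j).1 → i = j := ae_pi_positions_good hout hfst k
  -- a.s. the hard core is a function of the positions
  have hHae : ∀ᵐ x ∂P, H.indicator (1 : (Fin k → V3 × V3) → ℝ) x = Hq.indicator 1 (fun l => (x l).1) := by
    filter_upwards [hgood] with x hx
    have hiff : x ∈ H ↔ (fun l => (x l).1) ∈ Hq := hardCoreIn_superposeIn_iff σ Λ hx.1 hx.2 Y
    by_cases hxH : x ∈ H
    · simp only [Set.indicator_of_mem hxH, Set.indicator_of_mem (hiff.1 hxH), Pi.one_apply]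
    · simp only [Set.indicator_of_notMem hxH, Set.indicator_of_notMem (fun h' => hxH (hiff.2 h'))]
  set c : ℝ := ∫ v, h v * e v ∂γ with hc
  -- the generic term `1_H(x) 1_C(qᵢ) 1_D(qⱼ) · G(v)`: integrable, with integral `(position integral) · ∫ G dγ^{⊗k}`
  have hterm : ∀ {D : Set V3}, MeasurableSet D → ∀ (i j : Fin k) {G : (Fin k → V3) → ℝ},
      Integrable G (Measure.pi fun _ : Fin k => γ) →
      Integrable (fun x => (H.indicator 1 x * C.indicator (1 : V3 → ℝ) (x i).1 * D.indicator (1 : V3 → ℝ) (x j).1) *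
        G (fun l => (x l).2)) P ∧
      ∫ x, (H.indicator 1 x * C.indicator (1 : V3 → ℝ) (x i).1 * D.indicator (1 : V3 → ℝ) (x j).1) * G (fun l => (x l).2) ∂P =
        (∫ q, Hq.indicator 1 q * C.indicator (1 : V3 → ℝ) (q i) * D.indicator (1 : V3 → ℝ) (q j) ∂(Measure.pi fun _ : Fin k => π)) *
          ∫ v, G v ∂(Measure.pi fun _ : Fin k => γ) := by
    intro D hD i j G hG
    refine integrable_integral_posFactor_mul_vel π γ hG
      ((((measurable_one.indicator hHm).mul ((measurable_one.indicator hC).comp (measurable_pi_apply i).fst)).mul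
        ((measurable_one.indicator hD).comp (measurable_pi_apply j).fst))).aestronglyMeasurable (fun x => ?_)
      (hHae.mono fun x hx => by simp only [hx])
    have hn1 : ∀ (s : Set (Fin k → V3 × V3)) y, ‖s.indicator (1 : (Fin k → V3 × V3) → ℝ) y‖ ≤ 1 := fun s y =>
      (norm_indicator_le_norm_self _ _).trans (by simp)
    have hn2 : ∀ (s : Set V3) y, ‖s.indicator (1 : V3 → ℝ) y‖ ≤ 1 := fun s y => (norm_indicator_le_norm_self _ _).trans (by simp)
    rw [norm_mul, norm_mul]
    exact mul_le_one₀ (mul_le_one₀ (hn1 _ _) (norm_nonneg _) (hn2 _ _)) (norm_nonneg _) (hn2 _ _)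
  -- the velocity integrals
  have hvd : ∀ i : Fin k, ∫ v, h (v i) * e (v i) ∂(Measure.pi fun _ : Fin k => γ) = c := fun i =>
    integral_eval_pi γ (fun y => h y * e y) (hh.mul he) i
  have hvo : ∀ i j : Fin k, i ≠ j → ∫ v, h (v i) * e (v j) ∂(Measure.pi fun _ : Fin k => γ) = 0 := fun i j hij => by
    have hc' : (fun v : Fin k → V3 => h (v i) * e (v j)) = fun v => e (v j) * h (v i) := funext fun v => mul_comm _ _
    rw [hc']
    exact integral_cross_eq_zero γ e h he hh h0 (Ne.symm hij)
  have hvb : ∀ i : Fin k, ∫ v, h (v i) * b ∂(Measure.pi fun _ : Fin k => γ) = 0 := fun i => by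
    rw [integral_mul_const, integral_eval_pi γ h hh i, h0, zero_mul]
  have hv1 : ∫ _v, (1 : ℝ) ∂(Measure.pi fun _ : Fin k => γ) = 1 := by simp
  -- the explicit functional and its expansion on the hard-core event
  set Φ : (Fin k → V3 × V3) → ℝ := fun x => (∑ i, C.indicator (1 : V3 → ℝ) (x i).1 * h (x i).2) *
    ((∑ j, C'.indicator (1 : V3 → ℝ) (x j).1 * e (x j).2) - b) - c * ∑ i, (C ∩ C').indicator (1 : V3 → ℝ) (x i).1 with hΦ
  set T : Fin k → Fin k → (Fin k → V3 × V3) → ℝ := fun i j x =>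
    (H.indicator 1 x * C.indicator (1 : V3 → ℝ) (x i).1 * C'.indicator (1 : V3 → ℝ) (x j).1) *
      (fun v : Fin k → V3 => h (v i) * e (v j)) (fun l => (x l).2) with hT
  set T' : Fin k → (Fin k → V3 × V3) → ℝ := fun i x =>
    (H.indicator 1 x * C.indicator (1 : V3 → ℝ) (x i).1 * (univ : Set V3).indicator (1 : V3 → ℝ) (x i).1) *
      (fun v : Fin k → V3 => h (v i) * b) (fun l => (x l).2) with hT'
  set Dg : Fin k → (Fin k → V3 × V3) → ℝ := fun i x =>
    (H.indicator 1 x * C.indicator (1 : V3 → ℝ) (x i).1 * C'.indicator (1 : V3 → ℝ) (x i).1) *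
      (fun _ : Fin k → V3 => (1 : ℝ)) (fun l => (x l).2) with hDg
  have hTi : ∀ i j, Integrable (T i j) P ∧ ∫ x, T i j x ∂P =
      (∫ q, Hq.indicator 1 q * C.indicator (1 : V3 → ℝ) (q i) * C'.indicator (1 : V3 → ℝ) (q j) ∂(Measure.pi fun _ : Fin k => π)) *
        ∫ v, h (v i) * e (v j) ∂(Measure.pi fun _ : Fin k => γ) := fun i j =>
    hterm hC' i j (G := fun v => h (v i) * e (v j)) (by
      by_cases hij : i = j
      · subst hij; exact integrable_eval_pi γ hhe i
      · exact integrable_cross γ h e hh he hhi hei hij)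
  have hT'i : ∀ i, Integrable (T' i) P ∧ ∫ x, T' i x ∂P =
      (∫ q, Hq.indicator 1 q * C.indicator (1 : V3 → ℝ) (q i) * (univ : Set V3).indicator (1 : V3 → ℝ) (q i)
        ∂(Measure.pi fun _ : Fin k => π)) * ∫ v, h (v i) * b ∂(Measure.pi fun _ : Fin k => γ) := fun i =>
    hterm MeasurableSet.univ i i ((integrable_eval_pi γ hhi i).mul_const b)
  have hDi : ∀ i, Integrable (Dg i) P ∧ ∫ x, Dg i x ∂P =
      (∫ q, Hq.indicator 1 q * C.indicator (1 : V3 → ℝ) (q i) * C'.indicator (1 : V3 → ℝ) (q i) ∂(Measure.pi fun _ : Fin k => π)) *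
        ∫ _v, (1 : ℝ) ∂(Measure.pi fun _ : Fin k => γ) := fun i =>
    hterm hC' i i (integrable_const (1 : ℝ))
  set S : Fin k → (Fin k → V3 × V3) → ℝ := fun i x => (∑ j, T i j x) - T' i x - c * Dg i x with hS
  have hSi : ∀ i, Integrable (S i) P := fun i =>
    ((integrable_finsetSum _ fun j _ => (hTi i j).1).sub (hT'i i).1).sub ((hDi i).1.const_mul c)
  have hS0 : ∀ i, ∫ x, S i x ∂P = 0 := fun i => by
    have hI1 : Integrable (fun x => ∑ j, T i j x) P := integrable_finsetSum _ fun j _ => (hTi i j).1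
    have hI2 : Integrable (fun x => (∑ j, T i j x) - T' i x) P := hI1.sub (hT'i i).1
    have hI3 : Integrable (fun x => c * Dg i x) P := (hDi i).1.const_mul c
    simp only [hS]
    rw [integral_sub hI2 hI3, integral_sub hI1 (hT'i i).1, integral_finsetSum _ fun j _ => (hTi i j).1, integral_const_mul,
      Finset.sum_eq_single i (fun j _ hji => by rw [(hTi i j).2, hvo i j (Ne.symm hji), mul_zero])
        (fun hi => absurd (Finset.mem_univ i) hi), (hTi i i).2, hvd, (hT'i i).2, hvb, (hDi i).2, hv1]
    ring
  have hexp : ∀ x, H.indicator Φ x = ∑ i, S i x := fun x => by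
    by_cases hx : x ∈ H
    · have hd : ∀ q : V3, (C ∩ C').indicator (1 : V3 → ℝ) q = C.indicator 1 q * C'.indicator 1 q := fun q => by
        rw [Set.inter_indicator_one, Pi.mul_apply]
      simp only [hS, hT, hT', hDg, hΦ, Set.indicator_of_mem hx, Set.indicator_of_mem (mem_univ _), Pi.one_apply, one_mul,
        mul_one, hd]
      have h1 : ∀ i, C.indicator (1 : V3 → ℝ) (x i).1 * h (x i).2 * ((∑ j, C'.indicator (1 : V3 → ℝ) (x j).1 * e (x j).2) - b) =
          (∑ j, C.indicator (1 : V3 → ℝ) (x i).1 * C'.indicator (1 : V3 → ℝ) (x j).1 * (h (x i).2 * e (x j).2)) -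
            C.indicator (1 : V3 → ℝ) (x i).1 * (h (x i).2 * b) := fun i => by
        rw [mul_sub, Finset.mul_sum]
        exact congrArg₂ _ (Finset.sum_congr rfl fun j _ => by ring) (by ring)
      rw [Finset.sum_mul, Finset.mul_sum, ← Finset.sum_sub_distrib]
      exact Finset.sum_congr rfl fun i _ => by rw [h1 i]
    · simp [hS, hT, hT', hDg, Set.indicator_of_notMem hx]
  have hI0 : ∫ x in H, Φ x ∂P = 0 := by
    rw [← integral_indicator hHm]
    simp only [hexp]
    rw [integral_finsetSum _ fun i _ => hSi i]
    exact Finset.sum_eq_zero fun i _ => hS0 i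
  -- hence the positive and negative parts of `Φ` have the same (finite) integral over `H`, and `Fr ∘ superposeIn =ᵐ Φ`
  have hIH : Integrable Φ (P.restrict H) :=
    (integrable_indicator_iff hHm).1 (by rw [funext hexp]; exact integrable_finsetSum _ fun i _ => hSi i)
  have hA : ∫⁻ x in H, ENNReal.ofReal (Φ x) ∂P ≠ ⊤ := hIH.lintegral_lt_top.ne
  have hB : ∫⁻ x in H, ENNReal.ofReal (-Φ x) ∂P ≠ ⊤ := hIH.neg.lintegral_lt_top.ne
  have hAB : ∫⁻ x in H, ENNReal.ofReal (Φ x) ∂P = ∫⁻ x in H, ENNReal.ofReal (-Φ x) ∂P := by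
    have key := integral_eq_lintegral_pos_part_sub_lintegral_neg_part hIH
    rw [hI0] at key
    exact (ENNReal.toReal_eq_toReal_iff' hA hB).1 (by linarith)
  have hFrae : ∀ᵐ x ∂(P.restrict H), Fr (superposeIn Λ x Y) = Φ x := ae_restrict_of_ae (hgood.mono fun x hx => hFr x hx.1 hx.2)
  calc ∫⁻ x in H, ENNReal.ofReal (Fr (superposeIn Λ x Y)) ∂P = ∫⁻ x in H, ENNReal.ofReal (Φ x) ∂P :=
        lintegral_congr_ae (hFrae.mono fun x hx => by simp only [hx])
    _ = ∫⁻ x in H, ENNReal.ofReal (-Φ x) ∂P := hAB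
    _ = ∫⁻ x in H, ENNReal.ofReal (-Fr (superposeIn Λ x Y)) ∂P := lintegral_congr_ae (hFrae.mono fun x hx => by simp only [hx])

/-- **Second-order Campbell formula under a DLR state** (helper sub-goal S1 of stub `normSq_fluct_cellObs_eq`). For a hard-sphere
Gibbs state `μ` at inverse temperature `θ⁻¹` (any diameter `σ`, activity `z > 0`), continuous `h, e` of polynomial growth with
`∫ h dγ = 0` (`γ = 𝒩(0, θI)`), bounded measurable cells `C, C'` and a constant `b`:
`E_μ[(Σ_{q ∈ C} h(v)) · (Σ_{q ∈ C'} e(v) − b) − (∫ h e dγ) · #{q ∈ C ∩ C'}] = 0` (Bochner; `finsum`s) — in the double sum only the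
diagonal survives, with velocity factor `∫ h e dγ`. [folklore] -/
theorem gibbsCampbellSecondMoment : ∀ σ z θ : ℝ, 0 < z → 0 < θ → ∀ μ : MeasureTheory.Measure Literature.MathematicalPhysics.KineticTheory.MarkedConfig, Literature.Analysis.FluidPDE.IsHardSphereGibbs σ z θ⁻¹ (0 : Literature.MathematicalPhysics.KineticTheory.V3) μ → ∀ h e : Literature.MathematicalPhysics.KineticTheory.V3 → ℝ, Continuous h → Continuous e → (∃ (C : ℝ) (k : ℕ), ∀ v, |h v| ≤ C * (1 + ‖v‖) ^ k) → (∃ (C : ℝ) (k : ℕ), ∀ v, |e v| ≤ C * (1 + ‖v‖) ^ k) → (∫ v, h v ∂(Literature.MathematicalPhysics.KineticTheory.gaussMeasure (0 : Literature.MathematicalPhysics.KineticTheory.V3) θ) = 0) → ∀ C C' : Set Literature.MathematicalPhysics.KineticTheory.V3, MeasurableSet C → MeasurableSet C' → Bornology.IsBounded C → Bornology.IsBounded C' → ∀ b : ℝ, ∫ ω, ((∑ᶠ p ∈ (ω : Set (Literature.MathematicalPhysics.KineticTheory.V3 × Literature.MathematicalPhysics.KineticTheory.V3)), C.indicator (1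 : Literature.MathematicalPhysics.KineticTheory.V3 → ℝ) p.1 * h p.2) * ((∑ᶠ p ∈ (ω : Set (Literature.MathematicalPhysics.KineticTheory.V3 × Literature.MathematicalPhysics.KineticTheory.V3)), C'.indicator (1 : Literature.MathematicalPhysics.KineticTheory.V3 → ℝ) p.1 * e p.2) - b) - (∫ v, h v * e v ∂(Literature.MathematicalPhysics.KineticTheory.gaussMeasure (0 : Literature.MathematicalPhysics.KineticTheory.V3) θ)) * ∑ᶠ p ∈ (ω : Set (Literature.MathematicalPhysics.KineticTheory.V3 × Literature.MathematicalPhysics.KineticTheory.V3)), (C ∩ C').indicator (1 : Literature.MathematicalPhysics.KineticTheory.V3 → ℝ) p.1) ∂μ = 0 := by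
  -- adapted from `integral_windowStat_mul_sub_eq_zero` (…GibbsOrthogonality.lean): one more linear statistic, the count
  intro σ z θ hz hθ μ hG h e hh he hhG heG h0 C C' hC hC' hCb hC'b b
  obtain ⟨Ch, kh, hhg⟩ := hhG
  obtain ⟨Ce, ke, heg⟩ := heG
  classical
  haveI : IsProbabilityMeasure μ := hG.1
  set Λ : Set V3 := C ∪ C' ∪ Metric.ball (0 : V3) 1 with hΛdef
  have hΛ : MeasurableSet Λ := (hC.union hC').union measurableSet_ball
  have hΛb : Bornology.IsBounded Λ := (hCb.union hC'b).union Metric.isBounded_ball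
  have hc0 : volume Λ ≠ 0 :=
    (lt_of_lt_of_le (Metric.measure_ball_pos volume (0 : V3) one_pos) (measure_mono subset_union_right)).ne'
  have hctop : volume Λ ≠ ⊤ := hΛb.measure_lt_top.ne
  set π : Measure V3 := (volume Λ)⁻¹ • volume.restrict Λ with hπ
  haveI hπ1 : IsProbabilityMeasure π :=
    ⟨by rw [hπ, Measure.smul_apply, smul_eq_mul, Measure.restrict_apply_univ, ENNReal.inv_mul_cancel hc0 hctop]⟩
  have hmax : maxwellPhaseMeasure θ⁻¹ (0 : V3) Λ = volume Λ • π.prod (gaussMeasure (0 : V3) θ) := by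
    rw [maxwellPhaseMeasure_inv_eq_prod_gaussMeasure hθ (0 : V3) Λ, ← Measure.prod_smul_left, hπ, smul_smul,
      ENNReal.mul_inv_cancel hc0 hctop, one_smul]
  have hpi : ∀ k : ℕ, Measure.pi (fun _ : Fin k => maxwellPhaseMeasure θ⁻¹ (0 : V3) Λ) =
      volume Λ ^ k • Measure.pi (fun _ : Fin k => π.prod (gaussMeasure (0 : V3) θ)) := fun k => by
    haveI := sigmaFinite_maxwellPhaseMeasure θ⁻¹ (0 : V3) Λ
    refine Measure.pi_eq fun s _ => ?_
    rw [Measure.smul_apply, smul_eq_mul, Measure.pi_pi, hmax]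
    simp only [Measure.smul_apply, smul_eq_mul]
    rw [Finset.prod_mul_distrib, Finset.prod_const, Finset.card_univ, Fintype.card_fin]
  have hout : (π.prod (gaussMeasure (0 : V3) θ)) (Prod.fst ⁻¹' Λᶜ) = 0 := by
    rw [← Set.prod_univ, Measure.prod_prod, hπ, Measure.smul_apply, smul_eq_mul, Measure.restrict_apply hΛ.compl,
      Set.compl_inter_self, measure_empty, mul_zero, zero_mul]
  have hfst : ∀ q : V3, (π.prod (gaussMeasure (0 : V3) θ)) (Prod.fst ⁻¹' {q}) = 0 := fun q => by
    have h0' : (volume.restrict Λ) ({q} : Set V3) = 0 :=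
      nonpos_iff_eq_zero.1 ((Measure.le_iff'.1 Measure.restrict_le_self {q}).trans_eq (measure_singleton q))
    rw [← Set.prod_univ, Measure.prod_prod, hπ, Measure.smul_apply, smul_eq_mul, h0', mul_zero, zero_mul]
  -- Gaussian integrability
  have hhi : Integrable h (gaussMeasure (0 : V3) θ) := integrable_of_poly_growth _ hh.aestronglyMeasurable hhg
  have hei : Integrable e (gaussMeasure (0 : V3) θ) := integrable_of_poly_growth _ he.aestronglyMeasurable heg
  have hhe : Integrable (fun v => h v * e v) (gaussMeasure (0 : V3) θ) := by
    refine integrable_of_poly_growth _ (hh.mul he).aestronglyMeasurable (C := Ch * Ce) (k := kh + ke) fun v => ?_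
    rw [abs_mul, pow_add, mul_mul_mul_comm]
    exact mul_le_mul (hhg v) (heg v) (abs_nonneg _) ((abs_nonneg _).trans (hhg v))
  -- the observables and their measurable representatives
  set u₁ : V3 × V3 → ℝ := fun p => C.indicator (1 : V3 → ℝ) p.1 * h p.2 with hu₁
  set u₂ : V3 × V3 → ℝ := fun p => C'.indicator (1 : V3 → ℝ) p.1 * e p.2 with hu₂
  set u₃ : V3 × V3 → ℝ := fun p => (C ∩ C').indicator (1 : V3 → ℝ) p.1 with hu₃
  have hu₁m : Measurable u₁ := ((measurable_one.indicator hC).comp measurable_fst).mul (hh.measurable.comp measurable_snd)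
  have hu₂m : Measurable u₂ := ((measurable_one.indicator hC').comp measurable_fst).mul (he.measurable.comp measurable_snd)
  have hu₃m : Measurable u₃ := (measurable_one.indicator (hC.inter hC')).comp measurable_fst
  have hu₁0 : ∀ p : V3 × V3, p.1 ∉ Λ → u₁ p = 0 := fun p hp => by
    simp only [hu₁, Set.indicator_of_notMem (fun h' => hp (subset_union_left (subset_union_left h'))), zero_mul]
  have hu₂0 : ∀ p : V3 × V3, p.1 ∉ Λ → u₂ p = 0 := fun p hp => by
    simp only [hu₂, Set.indicator_of_notMem (fun h' => hp (subset_union_left (subset_union_right h'))), zero_mul]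
  have hu₃0 : ∀ p : V3 × V3, p.1 ∉ Λ → u₃ p = 0 := fun p hp => by
    simp only [hu₃, Set.indicator_of_notMem (fun h' : p.1 ∈ C ∩ C' => hp (subset_union_left (subset_union_left h'.1)))]
  set Xr : PointConfig (V3 × V3) → ℝ := fun ω => (posSum u₁ ω).toReal - (posSum (fun p => -u₁ p) ω).toReal with hXr
  set Yr : PointConfig (V3 × V3) → ℝ := fun ω => (posSum u₂ ω).toReal - (posSum (fun p => -u₂ p) ω).toReal with hYr
  set Nr : PointConfig (V3 × V3) → ℝ := fun ω => (posSum u₃ ω).toReal - (posSum (fun p => -u₃ p) ω).toReal with hNr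
  set c : ℝ := ∫ v, h v * e v ∂(gaussMeasure (0 : V3) θ) with hc
  set Fr : PointConfig (V3 × V3) → ℝ := fun ω => Xr ω * (Yr ω - b) - c * Nr ω with hFr
  have hFm : Measurable Fr :=
    (((measurable_posSum hu₁m).ennreal_toReal.sub (measurable_posSum hu₁m.neg).ennreal_toReal).mul
      (((measurable_posSum hu₂m).ennreal_toReal.sub (measurable_posSum hu₂m.neg).ennreal_toReal).sub measurable_const)).sub
      (((measurable_posSum hu₃m).ennreal_toReal.sub (measurable_posSum hu₃m.neg).ennreal_toReal).const_mul c)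
  have hFm' : Measurable fun ω => -Fr ω := hFm.neg
  -- a.s. finitely many particles above `Λ`, where the statistics agree with their representatives
  have hfinI : ∫⁻ ω, ((ω.count (Λ ×ˢ (univ : Set V3)) : ℕ∞) : ℝ≥0∞) ∂μ ≠ ⊤ := by
    refine ne_top_of_le_ne_top (tsum_ofReal_pow_div_factorial_mul_lt_top hz.le ?_).ne (lintegral_count_le_of_isHardSphereGibbs hG hΛ hΛb)
    rw [hmax, Measure.smul_apply, smul_eq_mul, measure_univ, mul_one]
    exact hctop
  have hrep : (fun ω : PointConfig (V3 × V3) => (∑ᶠ p ∈ (ω : Set (V3 × V3)), u₁ p) * ((∑ᶠ p ∈ (ω : Set (V3 × V3)), u₂ p) - b) -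
      c * ∑ᶠ p ∈ (ω : Set (V3 × V3)), u₃ p) =ᵐ[μ] Fr := by
    filter_upwards [ae_lt_top (measurable_toENNReal_count (hΛ.prod MeasurableSet.univ)) hfinI] with ω hω
    rw [ENat.toENNReal_lt_top] at hω
    have hω' : (ω.carrier ∩ Λ ×ˢ (univ : Set V3)).Finite := Set.encard_lt_top_iff.1 hω
    rw [finsum_mem_eq_toReal_posSum_sub hu₁0 hω', finsum_mem_eq_toReal_posSum_sub hu₂0 hω', finsum_mem_eq_toReal_posSum_sub hu₃0 hω']
  show ∫ ω, (∑ᶠ p ∈ (ω : Set (V3 × V3)), u₁ p) * ((∑ᶠ p ∈ (ω : Set (V3 × V3)), u₂ p) - b) -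
      c * ∑ᶠ p ∈ (ω : Set (V3 × V3)), u₃ p ∂μ = 0
  refine (integral_congr_ae hrep).trans ?_
  by_cases hint : Integrable Fr μ
  swap
  · exact integral_undef hint
  rw [integral_eq_lintegral_pos_part_sub_lintegral_neg_part hint, sub_eq_zero]
  congr 1
  -- DLR: both sides disintegrate along the specification of the window `Λ`, fibrewise equal
  rw [lintegral_eq_lintegral_gibbsSpecMeasure hG hΛ hΛb hFm.ennreal_ofReal.aemeasurable,
    lintegral_eq_lintegral_gibbsSpecMeasure hG hΛ hΛb hFm'.ennreal_ofReal.aemeasurable]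
  refine lintegral_congr fun Y => ?_
  rw [lintegral_gibbsSpecMeasure, lintegral_gibbsSpecMeasure, lintegral_gibbsWeightMeasure σ z θ⁻¹ (0 : V3) hΛ Y hFm.ennreal_ofReal,
    lintegral_gibbsWeightMeasure σ z θ⁻¹ (0 : V3) hΛ Y hFm'.ennreal_ofReal]
  congr 1
  refine tsum_congr fun k => ?_
  rw [hpi k, Measure.restrict_smul, lintegral_smul_measure, lintegral_smul_measure]
  congr 2
  refine setLIntegral_hardCore_ofReal_eq_neg_diag hΛ hC hC' hout hfst hh.measurable he.measurable hhi hei hhe h0 b σ Y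
    fun x hx hinj => ?_
  have hinj' : Function.Injective x := fun i j hij => hinj i j (by rw [hij])
  simp only [hFr, hXr, hYr, hNr]
  rw [toReal_posSum_sub_superposeIn hu₁0 hx hinj' Y, toReal_posSum_sub_superposeIn hu₂0 hx hinj' Y,
    toReal_posSum_sub_superposeIn hu₃0 hx hinj' Y]

/-! ## S2: the intensity measure of a translation-invariant law is a multiple of Lebesgue measure -/

/-- **Intensity of a translation-invariant law.** If an s-finite law `μ` on marked configurations is invariant under the spatial
shifts and has finite intensity on compact windows, then `E_μ[#{q ∈ B}] = E_μ[#{q ∈ [0,1)³}] · vol(B)` for every bounded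
measurable `B` (the intensity measure `B ↦ E_μ[#{q ∈ B}]` of positions is a translation-invariant Radon measure on `ℝ³`, hence a
multiple of Lebesgue measure by uniqueness of Haar measure). [folklore] -/
theorem lintegral_count_eq_mul_volume {μ : Measure MarkedConfig} [SFinite μ] (hinv : ∀ x : V3, MeasurePreserving (spatialShift x) μ μ)
    (hfin : ∀ K : Set V3, IsCompact K → ∫⁻ ω, ((ω.count (K ×ˢ (univ : Set V3)) : ℕ∞) : ℝ≥0∞) ∂μ ≠ ⊤) {B : Set V3}
    (hB : MeasurableSet B) (hBb : Bornology.IsBounded B) :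
    ∫⁻ ω, ((ω.count (B ×ˢ (univ : Set V3)) : ℕ∞) : ℝ≥0∞) ∂μ =
      (∫⁻ ω, ((ω.count ((unitCell : Set V3) ×ˢ (univ : Set V3)) : ℕ∞) : ℝ≥0∞) ∂μ) * volume B := by
  -- the intensity measure of the positions
  set ν : Measure V3 := (μ.bind PointConfig.toMeasure).map Prod.fst with hν
  have hκ : Measurable (PointConfig.toMeasure : MarkedConfig → Measure (V3 × V3)) := PointConfig.countKernel.measurable
  have hνapp : ∀ s : Set V3, MeasurableSet s → ν s = ∫⁻ ω, ((ω.count (s ×ˢ (univ : Set V3)) : ℕ∞) : ℝ≥0∞) ∂μ := by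
    intro s hs
    rw [hν, Measure.map_apply measurable_fst hs, Measure.bind_apply (measurable_fst hs) hκ.aemeasurable]
    refine lintegral_congr fun ω => ?_
    rw [PointConfig.toMeasure_apply _ (measurable_fst hs), ← Set.prod_univ]
  haveI : IsFiniteMeasureOnCompacts ν := ⟨fun K hK => by rw [hνapp K hK.measurableSet]; exact (hfin K hK).lt_top⟩
  haveI : ν.IsAddLeftInvariant := ⟨fun a => by
    refine Measure.ext fun s hs => ?_
    rw [Measure.map_apply (measurable_const_add a) hs, hνapp _ (measurable_const_add a hs), hνapp s hs]
    calc ∫⁻ ω, (((ω.count (((a + ·) ⁻¹' s) ×ˢ (univ : Set V3))) : ℕ∞) : ℝ≥0∞) ∂μ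
        = ∫⁻ ω, ((((spatialShift a ω).count (s ×ˢ (univ : Set V3))) : ℕ∞) : ℝ≥0∞) ∂μ := by
          refine lintegral_congr fun ω => ?_
          rw [spatialShift_apply, PointConfig.count_translate]
          congr 3
          ext p
          simp only [Set.mem_preimage, Set.mem_prod, Set.mem_univ, and_true, Prod.fst_add, add_comm]
      _ = ∫⁻ ω, ((ω.count (s ×ˢ (univ : Set V3)) : ℕ∞) : ℝ≥0∞) ∂μ :=
          (hinv a).lintegral_comp (measurable_toENNReal_count (hs.prod MeasurableSet.univ))⟩
  have hcell : ν unitCell = Measure.addHaarScalarFactor ν volume := by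
    have h1 := Measure.measure_isAddInvariant_eq_smul_of_isCompact_closure ν volume (s := (unitCell : Set V3))
      isBounded_unitCell.isCompact_closure
    rw [h1, ENNReal.smul_def, smul_eq_mul, show volume (unitCell : Set V3) = 1 from
      Literature.MathematicalPhysics.StatisticalMechanics.volume_unitCube, mul_one]
  rw [← hνapp B hB, ← hνapp unitCell measurableSet_unitCell, hcell,
    Measure.measure_isAddInvariant_eq_smul_of_isCompact_closure ν volume hBb.isCompact_closure, ENNReal.smul_def, smul_eq_mul]

end Summit.AtomisticToContinuum.HydrodynamicLimit.Theorems.MourreKoopmanChargesOneBodyCompleteness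

end
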